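import Mathlib
import Literature.Analysis.OperatorTheory.Enflo2023.MinimalNorm
import Literature.Analysis.ODE.RecursiveSeries
import HarnessLib

/-!
# Enflo 2023, v2 eq. (2)–(4): the operator `V_y : ℓ² → H`, its adjoint in coordinates, the shift, and (9) for `V_y`

Source under adjudication: Per H. Enflo, *On the invariant subspace problem in Hilbert spaces*, arXiv:2305.15442 (v1
2023, v2 2024), bib key `Enflo2023` — a CLAIMED proof of the invariant subspace problem for operators on a separable
Hilbert space.  This file is part of the kernel-tight typing of the manuscript by the b2b-enflo repair cell
(formaliser 1, Part A: v2 eq. (1)–(27), the set-up, the constructions `V_y`, `ℓ'`, `[ ]x₀`, Lemma 1 and Case I/II of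
the main step).  It records what FOLLOWS (proved implications from the manuscript's displayed hypotheses) and, where a
step does not follow, the typed inference together with its refutation.  NOTHING here asserts that the manuscript's
main theorem holds; no declaration concludes the invariant subspace problem for an arbitrary operator.  Value
(BLOCK-2b): theorems / refutations of typed inferences about a text — not progress on the problem.

The ℓ²-INSTANCE of the operator `V_y` of the paper (Enflo, arXiv:2305.15442v2, §"Some notation and simple
observations", eq. (2)–(4), p.2):  for a bounded operator `T` on a complex Hilbert space `H` with `‖T‖ < 1`
(the paper puts `‖T‖_op = 10⁻²⁰`, p.12) and `y ∈ H`,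
      V_y : ℓ²(ℕ) → H,   a = (a_j) ↦ Σ_j a_j T^j y          (eq. (2): "ℓ(T)y = Σ a_j T^j y", ‖ℓ‖₂ = ‖a‖_{ℓ²}),
is a bounded linear map (`Literature.Analysis.OperatorTheory.Enflo2023.Vy.V`, `V_apply`, `norm_V_le`), its adjoint has coordinates
      (V_y* x)_j = ⟨x, T^j y⟩  (paper) = ⟪T^j y, x⟫_ℂ (Mathlib)        (eq. (3)–(4), `adjoint_V_coord`),
and the right shift `S` on ℓ² (`Literature.Analysis.OperatorTheory.Enflo2023.Vy.S`, an isometry, `norm_S_le`) intertwines:  V_y (S a) = T (V_y a)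
(`V_shift`) — this is the map "ℓ ↦ Tℓ" on coefficient sequences used in (9), so Part A's abstract theorems
(`Literature.Analysis.OperatorTheory.Enflo2023.IsMinimal.eq9/eq9'`, stated for ANY `V : E →L[ℂ] H` and any contraction `S` with `V∘S = T∘V`) apply to
the paper's `V_y` literally, and F2's `PartB/Pipeline` can be instantiated with `E = ℓ²`, `V n = V_{y'_n}`, `S` = shift.
No new axioms.
-/

open scoped InnerProductSpace ENNReal
open Literature.Analysis.ODE (shiftSeq shiftSeq_zero shiftSeq_succ)

noncomputable section

namespace Literature.Analysis.OperatorTheory.Enflo2023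

namespace Vy

/-- `ℓ²(ℕ, ℂ)` as Mathlib's `lp`. [folklore] -/
abbrev ℓ2 : Type := lp (fun _ : ℕ => ℂ) 2

/-- `Σ_j |a_j|² = ‖a‖²` for `a ∈ ℓ²`. [folklore] -/
lemma hasSum_sq (a : ℓ2) : HasSum (fun j => ‖a j‖ ^ 2) (‖a‖ ^ 2) := by
  have h := lp.hasSum_norm (by norm_num : 0 < (2 : ℝ≥0∞).toReal) a
  simp only [ENNReal.toReal_ofNat, Real.rpow_two] at h
  exact h

/-- `Σ_j |a_j|²` converges for `a ∈ ℓ²`. [folklore] -/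
lemma summable_sq (a : ℓ2) : Summable (fun j => ‖a j‖ ^ 2) := (hasSum_sq a).summable

/-- Partial sums: `Σ_{j∈s} |a_j|² ≤ ‖a‖²` for `a ∈ ℓ²`. [folklore] -/
lemma sum_sq_le (a : ℓ2) (s : Finset ℕ) : ∑ j ∈ s, ‖a j‖ ^ 2 ≤ ‖a‖ ^ 2 :=
  sum_le_hasSum s (fun _ _ => sq_nonneg _) (hasSum_sq a)

variable {H : Type*} [NormedAddCommGroup H] [InnerProductSpace ℂ H] [CompleteSpace H]

omit [CompleteSpace H] in
/-- `‖T^j y‖ ≤ ‖T‖^j ‖y‖`. [folklore] -/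
lemma norm_pow_apply_le (T : H →L[ℂ] H) (j : ℕ) : ∀ y : H, ‖(T ^ j) y‖ ≤ ‖T‖ ^ j * ‖y‖ := by
  induction j with
  | zero => intro y; simp
  | succ j ih =>
      intro y
      rw [pow_succ]
      show ‖(T ^ j) (T y)‖ ≤ ‖T‖ ^ (j + 1) * ‖y‖
      calc ‖(T ^ j) (T y)‖ ≤ ‖T‖ ^ j * ‖T y‖ := ih (T y)
        _ ≤ ‖T‖ ^ j * (‖T‖ * ‖y‖) := by gcongr; exact T.le_opNorm y
        _ = ‖T‖ ^ (j + 1) * ‖y‖ := by ring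

omit [CompleteSpace H] in
/-- The terms `a_j • T^j y` are absolutely summable when `‖T‖ < 1` (AM–GM against `|a_j|² + ‖T‖^{2j}`). [cite: Enflo2023, v2 p.2, eq. (2)] -/
lemma summable_norm_terms (T : H →L[ℂ] H) (hT : ‖T‖ < 1) (y : H) (a : ℓ2) :
    Summable (fun j => ‖a j • (T ^ j) y‖) := by
  have hq0 : 0 ≤ ‖T‖ := norm_nonneg _
  have hg : Summable (fun j : ℕ => (‖a j‖ ^ 2 + (‖T‖ ^ 2) ^ j) / 2 * ‖y‖) :=
    (((summable_sq a).add (summable_geometric_of_lt_one (by positivity) (by nlinarith))).div_const 2).mul_right _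
  refine Summable.of_nonneg_of_le (fun j => norm_nonneg _) (fun j => ?_) hg
  rw [norm_smul]
  calc ‖a j‖ * ‖(T ^ j) y‖ ≤ ‖a j‖ * (‖T‖ ^ j * ‖y‖) := by gcongr; exact norm_pow_apply_le T j y
    _ = (‖a j‖ * ‖T‖ ^ j) * ‖y‖ := by ring
    _ ≤ (‖a j‖ ^ 2 + (‖T‖ ^ 2) ^ j) / 2 * ‖y‖ := by
        gcongr
        have := two_mul_le_add_sq ‖a j‖ (‖T‖ ^ j)
        rw [← pow_mul, mul_comm 2 j, pow_mul]
        linarith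

/-- The series `Σ_j a_j T^j y` of (2) converges in `H` (absolutely) when `‖T‖ < 1` and `a ∈ ℓ²`. [cite: Enflo2023, v2 p.2, eq. (2)] -/
lemma summable_terms (T : H →L[ℂ] H) (hT : ‖T‖ < 1) (y : H) (a : ℓ2) :
    Summable (fun j => a j • (T ^ j) y) :=
  (summable_norm_terms T hT y a).of_norm

omit [CompleteSpace H] in
/-- `Σ_j |a_j| ‖T‖^j` converges for `a ∈ ℓ²`, `‖T‖ < 1` (AM–GM against `|a_j|² + ‖T‖^{2j}`). [folklore] -/
lemma summable_coeff (T : H →L[ℂ] H) (hT : ‖T‖ < 1) (a : ℓ2) :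
    Summable (fun j => ‖a j‖ * ‖T‖ ^ j) := by
  have hq0 : 0 ≤ ‖T‖ := norm_nonneg _
  have hg : Summable (fun j : ℕ => (‖a j‖ ^ 2 + (‖T‖ ^ 2) ^ j) / 2) :=
    ((summable_sq a).add (summable_geometric_of_lt_one (by positivity) (by nlinarith))).div_const 2
  refine Summable.of_nonneg_of_le (fun j => by positivity) (fun j => ?_) hg
  have := two_mul_le_add_sq ‖a j‖ (‖T‖ ^ j)
  rw [← pow_mul, mul_comm 2 j, pow_mul]
  linarith

omit [CompleteSpace H] in
/-- Cauchy–Schwarz bound on the coefficient series: `Σ_j |a_j| ‖T‖^j ≤ ‖a‖ (1 − ‖T‖²)^{-1/2}`. [folklore] -/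
lemma tsum_coeff_le (T : H →L[ℂ] H) (hT : ‖T‖ < 1) (a : ℓ2) :
    ∑' j, ‖a j‖ * ‖T‖ ^ j ≤ ‖a‖ * Real.sqrt (1 / (1 - ‖T‖ ^ 2)) := by
  have hq0 : 0 ≤ ‖T‖ := norm_nonneg _
  have hq2 : ‖T‖ ^ 2 < 1 := by nlinarith
  have hgeo : HasSum (fun j : ℕ => (‖T‖ ^ 2) ^ j) (1 - ‖T‖ ^ 2)⁻¹ :=
    hasSum_geometric_of_lt_one (by positivity) hq2
  refine Real.tsum_le_of_sum_le (fun j => by positivity) (fun s => ?_)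
  have hcs := Finset.sum_mul_sq_le_sq_mul_sq s (fun j => ‖a j‖) (fun j => ‖T‖ ^ j)
  have h1 : ∑ j ∈ s, (‖T‖ ^ j) ^ 2 ≤ (1 - ‖T‖ ^ 2)⁻¹ := by
    have := sum_le_hasSum s (fun j _ => by positivity) hgeo
    refine le_trans (le_of_eq ?_) this
    refine Finset.sum_congr rfl (fun j _ => ?_)
    rw [← pow_mul, mul_comm j 2, pow_mul]
  have h2 := sum_sq_le a s
  have hS0 : 0 ≤ ∑ j ∈ s, ‖a j‖ * ‖T‖ ^ j := Finset.sum_nonneg (fun j _ => by positivity)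
  have hrhs : 0 ≤ ‖a‖ * Real.sqrt (1 / (1 - ‖T‖ ^ 2)) := by positivity
  have key : (∑ j ∈ s, ‖a j‖ * ‖T‖ ^ j) ^ 2 ≤ (‖a‖ * Real.sqrt (1 / (1 - ‖T‖ ^ 2))) ^ 2 := by
    rw [mul_pow, Real.sq_sqrt (by positivity), one_div]
    calc (∑ j ∈ s, ‖a j‖ * ‖T‖ ^ j) ^ 2 ≤ (∑ j ∈ s, ‖a j‖ ^ 2) * ∑ j ∈ s, (‖T‖ ^ j) ^ 2 := hcs
      _ ≤ ‖a‖ ^ 2 * (1 - ‖T‖ ^ 2)⁻¹ := by gcongr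
  exact pow_le_pow_iff_left₀ hS0 hrhs (by norm_num : (2:ℕ) ≠ 0) |>.1 key

/-- The linear map `a ↦ Σ_j a_j T^j y`. [cite: Enflo2023, v2 p.2, eq. (2)] -/
def Vlin (T : H →L[ℂ] H) (hT : ‖T‖ < 1) (y : H) : ℓ2 →ₗ[ℂ] H where
  toFun a := ∑' j, a j • (T ^ j) y
  map_add' a b := by
    have ha := summable_terms T hT y a
    have hb := summable_terms T hT y b
    rw [← ha.tsum_add hb]
    congr 1; ext j
    rw [lp.coeFn_add, Pi.add_apply, add_smul]
  map_smul' c a := by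
    have ha := summable_terms T hT y a
    rw [RingHom.id_apply, ← ha.tsum_const_smul c]
    congr 1; ext j
    rw [lp.coeFn_smul, Pi.smul_apply, smul_eq_mul, smul_smul]

/-- Unfolding `Vlin`: `Vlin a = Σ_j a_j T^j y`. [cite: Enflo2023, v2 p.2, eq. (2)] -/
lemma Vlin_apply (T : H →L[ℂ] H) (hT : ‖T‖ < 1) (y : H) (a : ℓ2) :
    Vlin T hT y a = ∑' j, a j • (T ^ j) y := rfl

/-- The bound `‖Σ_j a_j T^j y‖ ≤ ‖y‖(1 − ‖T‖²)^{-1/2}‖a‖` that makes `V_y` bounded. [cite: Enflo2023, v2 p.2, eq. (2)] -/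
lemma norm_Vlin_le (T : H →L[ℂ] H) (hT : ‖T‖ < 1) (y : H) (a : ℓ2) :
    ‖Vlin T hT y a‖ ≤ ‖y‖ * Real.sqrt (1 / (1 - ‖T‖ ^ 2)) * ‖a‖ := by
  rw [Vlin_apply]
  have h1 := norm_tsum_le_tsum_norm (summable_norm_terms T hT y a)
  have h2 : ∑' j, ‖a j • (T ^ j) y‖ ≤ ∑' j, ‖a j‖ * ‖T‖ ^ j * ‖y‖ := by
    refine Summable.tsum_le_tsum (fun j => ?_) (summable_norm_terms T hT y a) ((summable_coeff T hT a).mul_right _)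
    rw [norm_smul, mul_assoc]
    gcongr
    exact norm_pow_apply_le T j y
  have h3 : ∑' j, ‖a j‖ * ‖T‖ ^ j * ‖y‖ = (∑' j, ‖a j‖ * ‖T‖ ^ j) * ‖y‖ := tsum_mul_right
  have h4 := tsum_coeff_le T hT a
  have hy := norm_nonneg y
  calc ‖∑' j, a j • (T ^ j) y‖ ≤ (∑' j, ‖a j‖ * ‖T‖ ^ j) * ‖y‖ := by linarith
    _ ≤ (‖a‖ * Real.sqrt (1 / (1 - ‖T‖ ^ 2))) * ‖y‖ := by gcongr
    _ = ‖y‖ * Real.sqrt (1 / (1 - ‖T‖ ^ 2)) * ‖a‖ := by ring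

/-- **`V_y` (paper (2)) as a bounded operator `ℓ² → H`.** [cite: Enflo2023, v2 p.2, eq. (2)] -/
def V (T : H →L[ℂ] H) (hT : ‖T‖ < 1) (y : H) : ℓ2 →L[ℂ] H :=
  (Vlin T hT y).mkContinuous (‖y‖ * Real.sqrt (1 / (1 - ‖T‖ ^ 2))) (norm_Vlin_le T hT y)

/-- Unfolding `V_y`: `V_y a = Σ_j a_j T^j y` (eq. (2): `ℓ(T)y` with `‖ℓ‖₂ = ‖a‖_{ℓ²}`). [cite: Enflo2023, v2 p.2, eq. (2)] -/
@[simp] lemma V_apply (T : H →L[ℂ] H) (hT : ‖T‖ < 1) (y : H) (a : ℓ2) :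
    V T hT y a = ∑' j, a j • (T ^ j) y := rfl

/-- Operator-norm bound `‖V_y‖ ≤ ‖y‖(1 − ‖T‖²)^{-1/2}`. [cite: Enflo2023, v2 p.2, eq. (2)] -/
lemma norm_V_le (T : H →L[ℂ] H) (hT : ‖T‖ < 1) (y : H) :
    ‖V T hT y‖ ≤ ‖y‖ * Real.sqrt (1 / (1 - ‖T‖ ^ 2)) :=
  LinearMap.mkContinuous_norm_le _ (by positivity) _

/-- `V_y e_j = T^j y`. [cite: Enflo2023, v2 p.2, eq. (2)–(4)] -/
lemma V_single (T : H →L[ℂ] H) (hT : ‖T‖ < 1) (y : H) (j : ℕ) :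
    V T hT y (lp.single 2 j (1:ℂ)) = (T ^ j) y := by
  rw [V_apply, tsum_eq_single j]
  · rw [lp.single_apply, Pi.single_eq_same, one_smul]
  · intro i hi
    rw [lp.single_apply, Pi.single_eq_of_ne hi, zero_smul]

/-- **(3)–(4): the `j`-th coordinate of `V_y* x` is `⟪T^j y, x⟫_ℂ`** (= the paper's `⟨x, T^j y⟩`; in particular
`V_y* V_y` has matrix `(⟪T^i y, T^j y⟫)`, eq. (4)). [cite: Enflo2023, v2 p.2, eq. (3)–(4)] -/
theorem adjoint_V_coord (T : H →L[ℂ] H) (hT : ‖T‖ < 1) (y x : H) (j : ℕ) :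
    (ContinuousLinearMap.adjoint (V T hT y) x) j = ⟪(T ^ j) y, x⟫_ℂ := by
  classical
  have h := lp.inner_single_left (𝕜 := ℂ) j (1:ℂ) (ContinuousLinearMap.adjoint (V T hT y) x)
  rw [ContinuousLinearMap.adjoint_inner_right, V_single] at h
  rw [h]
  simp

/-- `⟪V_y a, x⟫ = Σ_j conj(a_j) ⟪T^j y, x⟫` — the adjoint in series form. [cite: Enflo2023, v2 p.2, eq. (3)] -/
theorem inner_V_left (T : H →L[ℂ] H) (hT : ‖T‖ < 1) (y x : H) (a : ℓ2) :
    ⟪V T hT y a, x⟫_ℂ = ∑' j, (starRingEnd ℂ) (a j) * ⟪(T ^ j) y, x⟫_ℂ := by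
  rw [← ContinuousLinearMap.adjoint_inner_right, lp.inner_eq_tsum]
  congr 1; ext j
  rw [adjoint_V_coord]
  simp [mul_comm]

/-! ### The right shift on ℓ² and the intertwining `V_y ∘ S = T ∘ V_y` -/

-- The right shift of a sequence `(a₀, a₁, …) ↦ (0, a₀, a₁, …)` is the landed `Literature.Analysis.ODE.shiftSeq`
-- (`shiftSeq_zero`, `shiftSeq_succ`), imported and opened above (de-duplication).

/-- The right shift preserves square-summability. [folklore] -/
lemma memℓp_shiftSeq (a : ℓ2) : Memℓp (shiftSeq a) 2 := by
  rw [memℓp_gen_iff (by norm_num : 0 < (2 : ℝ≥0∞).toReal)]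
  simp only [ENNReal.toReal_ofNat, Real.rpow_two]
  have h : Summable (fun j => ‖shiftSeq a (j + 1)‖ ^ 2) := by
    simp only [shiftSeq_succ]; exact summable_sq a
  exact (summable_nat_add_iff 1).1 h

/-- The right shift as a linear map on ℓ². [folklore] -/
def Slin : ℓ2 →ₗ[ℂ] ℓ2 where
  toFun a := ⟨shiftSeq a, memℓp_shiftSeq a⟩
  map_add' a b := by
    apply lp.ext
    funext j
    cases j with
    | zero => simp
    | succ j => simp
  map_smul' c a := by
    apply lp.ext
    funext j
    cases j with
    | zero => simp
    | succ j => simp [lp.coeFn_smul]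

/-- `(S a)₀ = 0` for the linear right shift. [folklore] -/
lemma Slin_apply_zero (a : ℓ2) : (Slin a) 0 = 0 := rfl
/-- `(S a)_{j+1} = a_j` for the linear right shift. [folklore] -/
lemma Slin_apply_succ (a : ℓ2) (j : ℕ) : (Slin a) (j + 1) = a j := rfl

/-- The right shift is an isometry of ℓ²: `‖S a‖ = ‖a‖`. [folklore] -/
lemma norm_Slin (a : ℓ2) : ‖Slin a‖ = ‖a‖ := by
  have h1 := lp.norm_rpow_eq_tsum (by norm_num : 0 < (2 : ℝ≥0∞).toReal) (Slin a)
  have h2 := lp.norm_rpow_eq_tsum (by norm_num : 0 < (2 : ℝ≥0∞).toReal) a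
  simp only [ENNReal.toReal_ofNat, Real.rpow_two] at h1 h2
  have hs : Summable (fun j => ‖(Slin a) j‖ ^ 2) := by
    have := lp.hasSum_norm (by norm_num : 0 < (2 : ℝ≥0∞).toReal) (Slin a)
    simp only [ENNReal.toReal_ofNat, Real.rpow_two] at this
    exact this.summable
  rw [hs.tsum_eq_zero_add] at h1
  simp only [Slin_apply_zero, norm_zero, Slin_apply_succ] at h1
  have h3 : ‖Slin a‖ ^ 2 = ‖a‖ ^ 2 := by rw [h1, h2]; ring
  exact (pow_left_inj₀ (norm_nonneg _) (norm_nonneg _) two_ne_zero).1 h3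

/-- **The right shift `S` on ℓ²** (an isometry; `‖S‖ ≤ 1` is what (9) needs). [folklore] -/
def S : ℓ2 →L[ℂ] ℓ2 := Slin.mkContinuous 1 (fun a => by rw [norm_Slin, one_mul])

/-- `(S a)₀ = 0`. [folklore] -/
@[simp] lemma S_apply_zero (a : ℓ2) : (S a) 0 = 0 := rfl
/-- `(S a)_{j+1} = a_j`. [folklore] -/
@[simp] lemma S_apply_succ (a : ℓ2) (j : ℕ) : (S a) (j + 1) = a j := rfl

/-- The right shift is an isometry: `‖S a‖ = ‖a‖`. [folklore] -/
lemma norm_S_apply (a : ℓ2) : ‖S a‖ = ‖a‖ := norm_Slin a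

/-- `‖S‖ ≤ 1` — the contraction hypothesis of `IsMinimal.eq9`. [folklore] -/
lemma norm_S_le : ‖(S : ℓ2 →L[ℂ] ℓ2)‖ ≤ 1 :=
  LinearMap.mkContinuous_norm_le _ zero_le_one _

/-- **Intertwining: `V_y (S a) = T (V_y a)`** — the shift on coefficients is multiplication by `T` ("ℓ ↦ Tℓ" in (9)). [cite: Enflo2023, v2 p.4, eq. (9)] -/
theorem V_shift (T : H →L[ℂ] H) (hT : ‖T‖ < 1) (y : H) (a : ℓ2) :
    V T hT y (S a) = T (V T hT y a) := by
  rw [V_apply, V_apply, (summable_terms T hT y (S a)).tsum_eq_zero_add,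
    ContinuousLinearMap.map_tsum T (summable_terms T hT y a)]
  simp only [S_apply_zero, zero_smul, zero_add, S_apply_succ, map_smul]
  congr 1; ext j
  rw [pow_succ']
  rfl

/-- The ℓ²-norm identity `‖a‖² = Σ_j |a_j|²` ((16)–(17) bookkeeping, with `Literature.Analysis.OperatorTheory.Enflo2023.IsBracket.norm_sq_ell`). [folklore] -/
theorem norm_sq_eq_tsum (a : ℓ2) : ‖a‖ ^ 2 = ∑' j, ‖a j‖ ^ 2 := (hasSum_sq a).tsum_eq.symm

/-! ### Part A's (5)–(9) for the paper's own `V_y` -/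

/-- **(9) for `V_y`, all powers `k`**: if `a ≠ 0` is norm-minimal for `‖x₀ − V_y a‖ ≤ ε` (problem (1)), then
`|⟨T^k (V_y a), x₀ − V_y a⟩| ≤ εθ := ⟨V_y a, x₀ − V_y a⟩` for every `k ≥ 0` — Part A's abstract `IsMinimal.eq9'`
instantiated with `E = ℓ²`, `V = V_y`, `S` = the right shift (so nothing about the paper's `V_y` is left abstract). [cite: Enflo2023, v2 p.4, eq. (9)] -/
theorem eq9_pow (T : H →L[ℂ] H) (hT : ‖T‖ < 1) (y x₀ : H) (ε : ℝ) (a : ℓ2)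
    (ha : IsMinimal (V T hT y) x₀ ε a) (ha0 : a ≠ 0) (k : ℕ) :
    ‖⟪x₀ - V T hT y a, (T ^ k) (V T hT y a)⟫_ℂ‖ ≤ (⟪x₀ - V T hT y a, V T hT y a⟫_ℂ).re := by
  obtain ⟨C, hC0, hC⟩ := ha.kkt ha0
  have hVS : ∀ b, V T hT y ((S ^ k) b) = (T ^ k) (V T hT y b) :=
    IsMinimal.intertwine_pow (V := V T hT y) S T (V_shift T hT y) k
  exact IsMinimal.eq9' hC0 hC (S ^ k) (IsMinimal.opNorm_pow_le_one S norm_S_le k) (T ^ k) hVS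

/-- **(5)–(6) for `V_y` in coordinates**: the Lagrange identity `V_y*(x₀ − V_y a) = C·a` reads
`⟪T^j y, x₀ − V_y a⟫ = C a_j` for every `j` (this is the form used in `CaseII.lean`, hypotheses `hk0`, `hk1`). [cite: Enflo2023, v2 p.3, eq. (5)] -/
theorem kkt_coord (T : H →L[ℂ] H) (hT : ‖T‖ < 1) (y x₀ : H) (a : ℓ2) {C : ℝ}
    (hC : ContinuousLinearMap.adjoint (V T hT y) (x₀ - V T hT y a) = (C : ℂ) • a) (j : ℕ) :
    ⟪(T ^ j) y, x₀ - V T hT y a⟫_ℂ = (C : ℂ) * a j := by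
  have h := congrArg (fun b : ℓ2 => b j) hC
  simp only [lp.coeFn_smul, Pi.smul_apply, smul_eq_mul] at h
  rw [adjoint_V_coord] at h
  exact h

/-! ### The left shift and the first-coefficient decomposition `ℓ(T)y = a₀ y + T(…)` (v2 pp.8–13) -/

/-- Left shift of a sequence: `(a₀, a₁, a₂, …) ↦ (a₁, a₂, …)`. [folklore] -/
def unshiftSeq (a : ℕ → ℂ) : ℕ → ℂ := fun j => a (j + 1)

/-- `unshiftSeq a j = a (j+1)`. [folklore] -/
@[simp] lemma unshiftSeq_apply (a : ℕ → ℂ) (j : ℕ) : unshiftSeq a j = a (j + 1) := rfl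

/-- The left-shifted sequence of an ℓ² sequence is in ℓ². [folklore] -/
lemma memℓp_unshiftSeq (a : ℓ2) : Memℓp (unshiftSeq a) 2 := by
  rw [memℓp_gen_iff (by norm_num : 0 < (2 : ℝ≥0∞).toReal)]
  simp only [ENNReal.toReal_ofNat, Real.rpow_two, unshiftSeq_apply]
  exact (summable_nat_add_iff 1).2 (summable_sq a)

/-- The left shift as a linear map on ℓ². [folklore] -/
def Llin : ℓ2 →ₗ[ℂ] ℓ2 where
  toFun a := ⟨unshiftSeq a, memℓp_unshiftSeq a⟩
  map_add' a b := by
    apply lp.ext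
    funext j
    simp
  map_smul' c a := by
    apply lp.ext
    funext j
    simp [lp.coeFn_smul]

/-- `(Llin a) j = a (j+1)`. [folklore] -/
@[simp] lemma Llin_apply (a : ℓ2) (j : ℕ) : (Llin a) j = a (j + 1) := rfl

/-- `‖L a‖² = ‖a‖² − |a₀|²`. [folklore] -/
lemma norm_Llin_sq (a : ℓ2) : ‖Llin a‖ ^ 2 = ‖a‖ ^ 2 - ‖a 0‖ ^ 2 := by
  rw [norm_sq_eq_tsum, norm_sq_eq_tsum, (summable_sq a).tsum_eq_zero_add]
  simp only [Llin_apply]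
  ring

/-- `‖Llin a‖ ≤ ‖a‖`. [folklore] -/
lemma norm_Llin_le (a : ℓ2) : ‖Llin a‖ ≤ ‖a‖ := by
  have h := norm_Llin_sq a
  nlinarith [norm_nonneg (Llin a), norm_nonneg a, sq_nonneg ‖a 0‖]

/-- **The left shift** `L` on ℓ² (`‖L‖ ≤ 1`): drops the first coefficient. [folklore] -/
def L : ℓ2 →L[ℂ] ℓ2 := Llin.mkContinuous 1 (fun a => by rw [one_mul]; exact norm_Llin_le a)

/-- `(L a) j = a (j+1)`. [folklore] -/
@[simp] lemma L_apply (a : ℓ2) (j : ℕ) : (L a) j = a (j + 1) := rfl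

/-- `‖L a‖ ≤ ‖a‖`. [folklore] -/
lemma norm_L_apply_le (a : ℓ2) : ‖L a‖ ≤ ‖a‖ := norm_Llin_le a

/-- `‖L a‖² = ‖a‖² − |a₀|²`. [folklore] -/
lemma norm_L_apply_sq (a : ℓ2) : ‖L a‖ ^ 2 = ‖a‖ ^ 2 - ‖a 0‖ ^ 2 := norm_Llin_sq a

/-- **First-coefficient decomposition** (the `ℓ(T)y = a₀y + Σ_{j≥1} a_j T^j y` of v2 pp.8–13):
`V_y a = a₀ • y + T (V_y (L a))`. [cite: Enflo2023, v2 pp.8–13 (ℓ(T)y = a₀y + tail)] -/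
theorem V_decomp (T : H →L[ℂ] H) (hT : ‖T‖ < 1) (y : H) (a : ℓ2) :
    V T hT y a = a 0 • y + T (V T hT y (L a)) := by
  have h1 : ∀ z : H, (1 : H →L[ℂ] H) z = z := fun z => rfl
  rw [V_apply, V_apply, (summable_terms T hT y a).tsum_eq_zero_add,
    ContinuousLinearMap.map_tsum T (summable_terms T hT y (L a)), pow_zero, h1]
  simp only [L_apply, map_smul]
  congr 1
  refine tsum_congr fun j => ?_
  rw [pow_succ']
  rfl

/-- **Tail bound**: `‖V_y a − a₀ y‖ ≤ ‖T‖ · ‖y‖(1 − ‖T‖²)^{-1/2} · (‖a‖² − |a₀|²)^{1/2} ≤ ‖T‖·‖y‖(1 − ‖T‖²)^{-1/2}·‖a‖`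
(with `‖T‖ = 10⁻²⁰` this is the "smaller order of magnitude" of the tail used on pp.8–13). [cite: Enflo2023, v2 pp.8–13 (tail bound)] -/
theorem norm_V_sub_head_le (T : H →L[ℂ] H) (hT : ‖T‖ < 1) (y : H) (a : ℓ2) :
    ‖V T hT y a - a 0 • y‖ ≤ ‖T‖ * (‖y‖ * Real.sqrt (1 / (1 - ‖T‖ ^ 2))) * ‖L a‖ := by
  rw [V_decomp T hT y a, add_sub_cancel_left]
  calc ‖T (V T hT y (L a))‖ ≤ ‖T‖ * ‖V T hT y (L a)‖ := T.le_opNorm _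
    _ ≤ ‖T‖ * ((‖y‖ * Real.sqrt (1 / (1 - ‖T‖ ^ 2))) * ‖L a‖) := by
        gcongr; exact (V T hT y).le_of_opNorm_le (norm_V_le T hT y) (L a)
    _ = ‖T‖ * (‖y‖ * Real.sqrt (1 / (1 - ‖T‖ ^ 2))) * ‖L a‖ := by ring

/-- Hence `|a₀|‖y‖ − τ ≤ ‖V_y a‖ ≤ |a₀|‖y‖ + τ` with `τ := ‖T‖·‖y‖(1 − ‖T‖²)^{-1/2}·‖L a‖` — the vector input of the
`‖y‖`-bounds (23) (the real arithmetic is `Literature.Analysis.OperatorTheory.Enflo2023.norm_y_window`, `Extras.lean`). [cite: Enflo2023, v2 p.8, eq. (23)] -/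
theorem norm_V_window (T : H →L[ℂ] H) (hT : ‖T‖ < 1) (y : H) (a : ℓ2) :
    ‖a 0‖ * ‖y‖ - ‖T‖ * (‖y‖ * Real.sqrt (1 / (1 - ‖T‖ ^ 2))) * ‖L a‖ ≤ ‖V T hT y a‖ ∧
      ‖V T hT y a‖ ≤ ‖a 0‖ * ‖y‖ + ‖T‖ * (‖y‖ * Real.sqrt (1 / (1 - ‖T‖ ^ 2))) * ‖L a‖ := by
  have h := norm_V_sub_head_le T hT y a
  have e : ‖a 0 • y‖ = ‖a 0‖ * ‖y‖ := norm_smul _ _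
  constructor
  · have h2 : ‖a 0 • y‖ - ‖V T hT y a‖ ≤ ‖a 0 • y - V T hT y a‖ := norm_sub_norm_le _ _
    rw [norm_sub_rev] at h2
    linarith
  · have h2 : ‖V T hT y a‖ ≤ ‖V T hT y a - a 0 • y‖ + ‖a 0 • y‖ := by
      have := norm_add_le (V T hT y a - a 0 • y) (a 0 • y)
      rwa [sub_add_cancel] at this
    linarith

/-- Lemma 1 set-up (v2 p.8 l.-1): if `y` itself is within `ε` of `x₀` then `‖ℓ'_ε‖₂ ≤ 1`, because the coefficient
vector `e₀ = (1, 0, 0, …)` is feasible (`V_y e₀ = y`) and has norm `1`. [cite: Enflo2023, v2 p.8, Lemma 1 set-up] -/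
theorem norm_minimal_le_one (T : H →L[ℂ] H) (hT : ‖T‖ < 1) (y x₀ : H) (ε : ℝ) (a : ℓ2)
    (ha : IsMinimal (V T hT y) x₀ ε a) (hy : ‖x₀ - y‖ ≤ ε) : ‖a‖ ≤ 1 := by
  have h1 : ∀ z : H, (1 : H →L[ℂ] H) z = z := fun z => rfl
  have hfeas : lp.single 2 0 (1 : ℂ) ∈ feasible (V T hT y) x₀ ε := by
    show ‖x₀ - V T hT y (lp.single 2 0 (1 : ℂ))‖ ≤ ε
    rw [V_single, pow_zero, h1]; exact hy
  have h := ha.2 _ hfeas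
  rwa [lp.norm_single (by norm_num : (0 : ℝ≥0∞) < 2), norm_one] at h

end Vy

end Literature.Analysis.OperatorTheory.Enflo2023

end
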